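import Literature.NumberTheory.EllipticCurves.NeronSigmaFunctionAnalyticProofs
import Literature.NumberTheory.EllipticCurves.NeronSigmaFunctionProofs
import Literature.NumberTheory.EllipticCurves.NeronLocalHeightTateLemma
import Literature.NumberTheory.EllipticCurves.ComplexTorus
import Literature.NumberTheory.EllipticCurves.ComplexPeriod
import Literature.NumberTheory.EllipticCurves.LangHeightArchEstimateLemma5Proofs
import Mathlib.Topology.Algebra.Module.Cardinality
import Mathlib.Analysis.Normed.Group.FunctionSeries
import Mathlib.Analysis.Normed.Unbundled.RingSeminorm
import HarnessLib

/-!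
# ATAEC Thm. VI.3.2 by Tate's uniqueness: Tate's series on `E(ℂ)` is the Néron function; VI.3.4(b)

Topic `NumberTheory/EllipticCurves` (family `abc`, G06). Pure proofs (theorems only). This file
completes the archimedean local height theory behind
`Literature.NumberTheory.EllipticCurves.szpiro_imp_langHeightLowerBoundConjecture` (Hindry–Silverman
1988, Thm. 0.3) up to the `q`-product expansion of `σ`:

* `neronLocalHeight_param_eq_neronSigma` — **Silverman, *Advanced Topics*, Thm. VI.3.2** (with
  Thm. VI.1.1(b)): for an elliptic curve `W/ℂ` with period lattice `Λ` (`g₂(Λ) = c₄/12`,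
  `g₃(Λ) = c₆/216`) and its analytic parametrisation `u : ℂ →+ W(ℂ)`
  (`w ↦ (℘(w) − b₂/12, (℘'(w) − a₁x − a₃)/2)` off `Λ`, AEC VI.3.6(b)), Tate's series
  `λ = λ₁ + μ` (`WeierstrassCurve.Affine.Point.neronLocalHeight` for the absolute value of `ℂ`)
  satisfies `λ(u(w)) = neronSigma Λ w` for all `w ∉ Λ`;
* `neronLocalHeight_eq_neronFunction_of_qProduct` — the named fact
  `neronLocalHeight_eq_neronFunction` (**ATAEC Thm. VI.3.4(b)**, `LangHeightArchEstimate.lean`)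
  **follows from** the `q`-product of `σ` (Thm. I.6.4, the named fact
  `weierstrassSigma_ofUpperHalfPlane_eq_qProduct` of `NeronSigmaFunction.lean`), through VI.3.2,
  homothety invariance (`PeriodPair.neronSigma_mulLeft`) and VI.3.4
  (`neronSigma_ofUpperHalfPlane_eq_neronFunction`, `NeronSigmaFunctionProofs.lean`);
* the frontier of the formal proof of Szpiro ⇒ Lang over `ℚ` becomes
  `szpiro_imp_langHeightLowerBoundConjecture_of_lemma3_kodairaNeron_qProduct`: Petsche's Lemma 3
  (Tate's `p`-adic uniformisation), the Kodaira–Néron facts, and ATAEC Thm. I.6.4.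

## Proof of VI.3.2 (Tate's uniqueness, ATAEC Thm. VI.1.1 + VI.3.2)

Let `G(w) = λ(u(w)) − neronSigma Λ w` on `ℂ ∖ Λ`.

1. `u` vanishes on `Λ` (`param_eq_zero_of_mem`), and Tate's correction `f ∘ u` is continuous on
   all of `ℂ` (`continuous_tateCorrection_param`: off `Λ` it is the closed form in
   `x = ℘(w) − b₂/12`, continuous because `max(|φ₂|,|ψ₂²|)/max(|x|⁴,1) ≥ c₁ > 0`; at a lattice
   point `℘ → ∞` (the tree's `PeriodPair.tendsto_weierstrassP_cobounded`) while the quotient tends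
   to `1`, `tendsto_duplicationQuotient_cobounded`), so `μ ∘ u = Σ 4^{-(n+1)} f(u(2ⁿw))` is
   continuous (`continuous_tateMu_param`) and `λ ∘ u` is continuous off `Λ`.
2. Duplication: `λ(u(2w)) = 4λ(u(w)) − log|℘'(w)| + ¼log|Δ(W)|` (the tree's
   `neronLocalHeight_two_nsmul_of` with `tateCorrection_bounded_of_two_ne_zero`; `2y + a₁x + a₃ = ℘'(w)`)
   and `neronSigma(2w) = 4 neronSigma(w) − log|℘'(w)| + ¼log|Δ(Λ)|`
   (`PeriodPair.neronSigma_two_mul`), with `Δ(Λ) = Δ(W)`; so `G(2w) = 4G(w)` for `2w ∉ Λ`.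
3. Boundedness: `|λ − λ₁| ≤ C/3` (Tate) and `|λ₁ ∘ u − neronSigma| ≤ B`
   (`PeriodPair.exists_bound_posLog_sub_neronSigma`), so `|G| ≤ C/3 + B` off `Λ`.
4. Hence `G(w) = 4⁻ⁿG(2ⁿw) → 0` whenever `2ⁿw ∉ Λ` for all `n`; these `w` form the complement of a
   countable set, hence a dense set (Mathlib `Set.Countable.dense_compl`), and `G` is continuous
   off `Λ`, so `G = 0` on `ℂ ∖ Λ`.

## References

* J. H. Silverman, *Advanced Topics in the Arithmetic of Elliptic Curves* (1994), Thm. VI.1.1,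
  Lemma VI.1.2, Prop. VI.1.3, Thm. VI.3.2, Thm. VI.3.4; *The Arithmetic of Elliptic Curves*,
  2nd ed. (2009), Prop. VI.3.6.
* M. Hindry, J. H. Silverman, Invent. Math. 93 (1988), Thm. 0.3; C. Petsche, New York J. Math. 12
  (2006), Prop. 7.
-/

noncomputable section

open scoped UpperHalfPlane Real Topology

open Complex

namespace Literature.NumberTheory.EllipticCurves

open _root_.PeriodPair _root_.WeierstrassCurve _root_.WeierstrassCurve.Affine.Point Filter Topology Bornology

section Param

variable {W : WeierstrassCurve ℂ} {L : PeriodPair} (u : ℂ →+ W.toAffine.Point)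
  (hu : ∀ w ∉ L.lattice, ∃ hw, u w = .some (℘[L] w - W.b₂ / 12)
    ((℘'[L] w - W.a₁ * (℘[L] w - W.b₂ / 12) - W.a₃) / 2) hw)

include hu

/-- The analytic parametrisation vanishes on the lattice: it is additive and, off `Λ`, given by
the `Λ`-periodic functions `℘, ℘'`, so `u(ℓ + w) = u(w)` for `w ∉ Λ` (Silverman AEC VI.3.6(b):
the kernel of `φ : ℂ/Λ → E(ℂ)` is `Λ`). [cite: SilvermanAEC2009, Prop. VI.3.6(b)] -/
theorem param_eq_zero_of_mem {ℓ : ℂ} (hℓ : ℓ ∈ L.lattice) : u ℓ = 0 := by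
  have hw₀ : L.ω₁ / 2 ∉ L.lattice := L.ω₁_div_two_notMem_lattice
  have hw₁ : L.ω₁ / 2 + ℓ ∉ L.lattice := fun h => hw₀ (by simpa using sub_mem h hℓ)
  obtain ⟨h0, e0⟩ := hu (L.ω₁ / 2) hw₀
  obtain ⟨h1, e1⟩ := hu (L.ω₁ / 2 + ℓ) hw₁
  have hx : ℘[L] (L.ω₁ / 2 + ℓ) = ℘[L] (L.ω₁ / 2) := L.weierstrassP_add_coe (L.ω₁ / 2) ⟨ℓ, hℓ⟩
  have hy : ℘'[L] (L.ω₁ / 2 + ℓ) = ℘'[L] (L.ω₁ / 2) := L.derivWeierstrassP_add_coe (L.ω₁ / 2) ⟨ℓ, hℓ⟩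
  have key : u (L.ω₁ / 2 + ℓ) = u (L.ω₁ / 2) := by
    rw [e1, e0, WeierstrassCurve.Affine.Point.some.injEq]
    exact ⟨by rw [hx], by rw [hx, hy]⟩
  have h := map_add u (L.ω₁ / 2) ℓ
  rw [key] at h
  exact left_eq_add.mp h

/-- Off the lattice the parametrisation is an affine point, in particular `u(w) ≠ O`. [folklore] -/
theorem param_ne_zero_of_notMem {w : ℂ} (hw : w ∉ L.lattice) : u w ≠ 0 := by
  obtain ⟨h, e⟩ := hu w hw
  rw [e]
  exact WeierstrassCurve.Affine.Point.some_ne_zero _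

/-! ### Tate's correction along the parametrisation is continuous on `ℂ` -/

omit hu in
/-- **Tate's correction in closed form is continuous in `x`**: `x ↦ ½ log(max(|φ₂(x)|, |ψ₂²(x)|)/max(|x|⁴, 1)) − ¼ log|Δ|`
(ATAEC Lemma VI.1.2: the quotient is bounded below by a positive constant since `φ₂`, `ψ₂²` are
coprime — the tree's `exists_bounds_duplication_quotient`). [cite: Silverman1994, Lemma VI.1.2] -/
theorem continuous_tateClosedForm [W.IsElliptic] :
    Continuous fun x : ℂ => 1 / 2 * Real.log (max ‖(W.Φ 2).eval x‖ ‖W.Ψ₂Sq.eval x‖ / max (‖x‖ ^ 4) 1) -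
      1 / 4 * Real.log ‖W.Δ‖ := by
  obtain ⟨c₁, c₂, hc₁, -, hb⟩ := exists_bounds_duplication_quotient (NormedField.toAbsoluteValue ℂ) W
    (two_ne_zero)
  have hQ : Continuous fun x : ℂ => max ‖(W.Φ 2).eval x‖ ‖W.Ψ₂Sq.eval x‖ / max (‖x‖ ^ 4) 1 := by
    refine Continuous.div ?_ ?_ fun x => ?_
    · exact ((W.Φ 2).continuous.norm).max (W.Ψ₂Sq.continuous.norm)
    · exact (continuous_norm.pow 4).max continuous_const
    · exact (lt_max_of_lt_right one_pos).ne'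
  refine (continuous_const.mul (hQ.log fun x => ?_)).sub continuous_const
  have := (hb x).1
  exact (lt_of_lt_of_le hc₁ this).ne'

omit hu in
/-- `Q(x) = max(|φ₂(x)|, |ψ₂²(x)|)/max(|x|⁴, 1) → 1` as `|x| → ∞` (`φ₂` is monic of degree `4`,
`deg ψ₂² = 3`; ATAEC Lemma VI.1.2: "the quotient tends to `1` as `P → O`").
[cite: Silverman1994, Lemma VI.1.2] -/
theorem tendsto_duplicationQuotient_cobounded (W : WeierstrassCurve ℂ) :
    Tendsto (fun x : ℂ => max ‖(W.Φ 2).eval x‖ ‖W.Ψ₂Sq.eval x‖ / max (‖x‖ ^ 4) 1)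
      (cobounded ℂ) (𝓝 1) := by
  -- in terms of `t = x⁻¹ → 0`
  have hinv : Tendsto (fun x : ℂ => x⁻¹) (cobounded ℂ) (𝓝 0) := tendsto_inv₀_cobounded
  set g₁ : ℂ → ℂ := fun t => 1 - W.b₄ * t ^ 2 - 2 * W.b₆ * t ^ 3 - W.b₈ * t ^ 4 with hg₁
  set g₂ : ℂ → ℂ := fun t => 4 * t + W.b₂ * t ^ 2 + 2 * W.b₄ * t ^ 3 + W.b₆ * t ^ 4 with hg₂
  have hc₁ : Continuous g₁ := by
    rw [hg₁]
    fun_prop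
  have hc₂ : Continuous g₂ := by
    rw [hg₂]
    fun_prop
  have hg₁0 : g₁ 0 = 1 := by simp only [hg₁]; ring
  have hg₂0 : g₂ 0 = 0 := by simp only [hg₂]; ring
  have ht₁ : Tendsto (fun x : ℂ => ‖g₁ x⁻¹‖) (cobounded ℂ) (𝓝 1) := by
    have h := (hc₁.tendsto 0).comp hinv
    rw [hg₁0] at h
    have h' := h.norm
    rw [norm_one] at h'
    exact h'
  have ht₂ : Tendsto (fun x : ℂ => ‖g₂ x⁻¹‖) (cobounded ℂ) (𝓝 0) := by
    have h := (hc₂.tendsto 0).comp hinv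
    rw [hg₂0] at h
    have h' := h.norm
    rw [norm_zero] at h'
    exact h'
  have hmax : Tendsto (fun x : ℂ => max ‖g₁ x⁻¹‖ ‖g₂ x⁻¹‖) (cobounded ℂ) (𝓝 (max 1 0)) := ht₁.max ht₂
  rw [max_eq_left zero_le_one] at hmax
  refine hmax.congr' ?_
  filter_upwards [eventually_cobounded_le_norm (E := ℂ) 1] with x hx
  have hx0 : x ≠ 0 := fun h => by rw [h, norm_zero] at hx; norm_num at hx
  have hx4 : max (‖x‖ ^ 4) 1 = ‖x ^ 4‖ := by
    rw [norm_pow, max_eq_left (one_le_pow₀ hx)]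
  have hφ : (W.Φ 2).eval x = x ^ 4 * g₁ x⁻¹ := by
    simp only [hg₁, WeierstrassCurve.Φ_two, Polynomial.eval_sub, Polynomial.eval_mul, Polynomial.eval_C,
      Polynomial.eval_pow, Polynomial.eval_X]
    field_simp
  have hψ : W.Ψ₂Sq.eval x = x ^ 4 * g₂ x⁻¹ := by
    simp only [hg₂, WeierstrassCurve.Ψ₂Sq, Polynomial.eval_add, Polynomial.eval_mul, Polynomial.eval_C,
      Polynomial.eval_pow, Polynomial.eval_X]
    field_simp
  rw [hφ, hψ, hx4, norm_mul, norm_mul, ← mul_max_of_nonneg _ _ (norm_nonneg _),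
    mul_div_cancel_left₀ _ (norm_ne_zero_iff.mpr (pow_ne_zero 4 hx0))]

/-- Tate's correction along the parametrisation, `F = f ∘ u`, off the lattice: the closed form of
`tateCorrection` at the point `(℘(w) − b₂/12, …)`. [cite: Silverman1994, Lemma VI.1.2] -/
theorem tateCorrection_param_of_notMem {w : ℂ} (hw : w ∉ L.lattice) :
    tateCorrection (NormedField.toAbsoluteValue ℂ) (u w) =
      1 / 2 * Real.log (max ‖(W.Φ 2).eval (℘[L] w - W.b₂ / 12)‖ ‖W.Ψ₂Sq.eval (℘[L] w - W.b₂ / 12)‖ /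
        max (‖℘[L] w - W.b₂ / 12‖ ^ 4) 1) - 1 / 4 * Real.log ‖W.Δ‖ := by
  obtain ⟨h, e⟩ := hu w hw
  rw [e, tateCorrection_some]
  rfl

variable [W.IsElliptic]

/-- **Tate's correction along the parametrisation is continuous on all of `ℂ`** (ATAEC
Lemma VI.1.2: "`f` extends to a bounded continuous function on `E(K)`", transported to `ℂ` by
the parametrisation: off `Λ` it is the closed form in `x = ℘(w) − b₂/12`, and at a lattice point
`x → ∞` while `max(|φ|,|ψ|)/max(|x|⁴,1) → 1`, so `f → f(O) = ¼v(Δ)`).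
[cite: Silverman1994, Lemma VI.1.2] -/
theorem continuous_tateCorrection_param :
    Continuous fun w : ℂ => tateCorrection (NormedField.toAbsoluteValue ℂ) (u w) := by
  set fC : ℂ → ℝ := fun x : ℂ => 1 / 2 * Real.log (max ‖(W.Φ 2).eval x‖ ‖W.Ψ₂Sq.eval x‖ / max (‖x‖ ^ 4) 1) -
      1 / 4 * Real.log ‖W.Δ‖ with hfC
  have hfCc : Continuous fC := continuous_tateClosedForm
  set xf : ℂ → ℂ := fun w => ℘[L] w - W.b₂ / 12 with hxf
  have hopen : IsOpen ((L.lattice : Set ℂ)ᶜ) := L.isClosed_lattice.isOpen_compl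
  have heqOff : ∀ w, w ∉ L.lattice → tateCorrection (NormedField.toAbsoluteValue ℂ) (u w) = fC (xf w) :=
    fun w hw => tateCorrection_param_of_notMem u hu hw
  refine continuous_iff_continuousAt.mpr fun w₀ => ?_
  by_cases hw₀ : w₀ ∈ L.lattice
  · -- at a lattice point: `F w₀ = f(O)` and `F w → f(O)` along the punctured neighbourhood
    have hval : tateCorrection (NormedField.toAbsoluteValue ℂ) (u w₀) = -(1 / 4 * Real.log ‖W.Δ‖) := by
      rw [param_eq_zero_of_mem u hu hw₀, tateCorrection_zero]
      rfl
    -- punctured neighbourhoods of `w₀` avoid `Λ`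
    have hpunct : ∀ᶠ w in 𝓝[≠] w₀, w ∉ L.lattice := by
      have hcl : IsClosed ((L.lattice : Set ℂ) \ {w₀}) := L.isClosed_of_subset_lattice Set.sdiff_subset
      have hmem : ((L.lattice : Set ℂ) \ {w₀})ᶜ ∈ 𝓝 w₀ := hcl.isOpen_compl.mem_nhds (by simp)
      filter_upwards [mem_nhdsWithin_of_mem_nhds hmem, self_mem_nhdsWithin] with w h1 h2
      intro hw
      exact h1 ⟨hw, h2⟩
    -- `x(w) → ∞`
    have hx : Tendsto xf (𝓝[≠] w₀) (cobounded ℂ) := by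
      have h℘ := L.tendsto_weierstrassP_cobounded hw₀
      rw [← tendsto_norm_atTop_iff_cobounded] at h℘ ⊢
      have : Tendsto (fun w => ‖℘[L] w‖ - ‖W.b₂ / 12‖) (𝓝[≠] w₀) atTop :=
        tendsto_atTop_add_const_right _ _ h℘
      refine tendsto_atTop_mono (fun w => ?_) this
      have := norm_sub_norm_le (℘[L] w) (W.b₂ / 12)
      simp only [hxf]
      linarith
    have hlim : Tendsto (fun w => fC (xf w)) (𝓝[≠] w₀) (𝓝 (-(1 / 4 * Real.log ‖W.Δ‖))) := by
      have hQ := (tendsto_duplicationQuotient_cobounded W).comp hx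
      have hlog := (Real.continuousAt_log one_ne_zero).tendsto.comp hQ
      rw [Real.log_one] at hlog
      have := (hlog.const_mul (1 / 2)).sub_const (1 / 4 * Real.log ‖W.Δ‖)
      simp only [mul_zero, zero_sub] at this
      exact this
    -- assemble `ContinuousAt`
    rw [ContinuousAt, hval, ← nhdsNE_sup_pure w₀, tendsto_sup]
    constructor
    · refine hlim.congr' ?_
      filter_upwards [hpunct] with w hw
      exact (heqOff w hw).symm
    · rw [tendsto_pure_left]
      intro s hs
      rw [hval]
      exact mem_of_mem_nhds hs
  · -- off the lattice: locally `F = fC ∘ x`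
    have h℘ : ContinuousAt ℘[L] w₀ :=
      (L.differentiableOn_weierstrassP.differentiableAt (hopen.mem_nhds hw₀)).continuousAt
    have hxc : ContinuousAt xf w₀ := h℘.sub continuousAt_const
    have hcomp : ContinuousAt (fun w => fC (xf w)) w₀ := hfCc.continuousAt.comp hxc
    refine hcomp.congr ?_
    filter_upwards [hopen.mem_nhds hw₀] with w hw
    exact (heqOff w hw).symm


/-! ### Tate's series along the parametrisation -/

omit hu [W.IsElliptic] in
/-- The absolute value of `ℂ` as an `AbsoluteValue` (`NormedField.toAbsoluteValue`) is the norm.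
[folklore] -/
theorem toAbsoluteValue_complex_apply (x : ℂ) : NormedField.toAbsoluteValue ℂ x = ‖x‖ := rfl

omit hu [W.IsElliptic] in
/-- Tate's series `μ` along the parametrisation: `μ(u(w)) = Σ 4^{-(n+1)} f(u(2ⁿw))` (the group
laws elaborated with the classical and with `ℂ`'s decidable equality agree).
[cite: Silverman1994, Prop VI.1.3] -/
theorem tateMu_param (w : ℂ) :
    tateMu (NormedField.toAbsoluteValue ℂ) (u w) =
      ∑' n : ℕ, (1 / 4 : ℝ) ^ (n + 1) * tateCorrection (NormedField.toAbsoluteValue ℂ) (u (2 ^ n * w)) := by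
  unfold tateMu
  refine tsum_congr fun n => ?_
  congr 2
  rw [show (2 : ℂ) ^ n * w = (2 ^ n : ℕ) • w by simp [nsmul_eq_mul], map_nsmul]

/-- `μ ∘ u` is continuous on `ℂ`: a uniformly convergent series (`|f| ≤ C`, ATAEC Lemma VI.1.2,
the tree's `tateCorrection_bounded_of_two_ne_zero`) of continuous functions
(`continuous_tateCorrection_param`); ATAEC Prop. VI.1.3 / Thm. VI.1.1(a)(i).
[cite: Silverman1994, Prop VI.1.3] -/
theorem continuous_tateMu_param :
    Continuous fun w : ℂ => tateMu (NormedField.toAbsoluteValue ℂ) (u w) := by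
  obtain ⟨C, hC⟩ := tateCorrection_bounded_of_two_ne_zero (NormedField.toAbsoluteValue ℂ) W two_ne_zero
  have hF := continuous_tateCorrection_param u hu
  have hC0 : 0 ≤ C := le_trans (abs_nonneg _) (hC 0)
  simp_rw [tateMu_param u]
  refine continuous_tsum (fun n => ?_) ((summable_geometric_of_lt_one (by norm_num) (by norm_num :
    (1 / 4 : ℝ) < 1)).mul_left (C / 4)) fun n w => ?_
  · exact continuous_const.mul (hF.comp (continuous_const.mul continuous_id))
  · rw [Real.norm_eq_abs, abs_mul, abs_of_nonneg (by positivity), pow_succ]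
    calc (1 / 4 : ℝ) ^ n * (1 / 4) * |tateCorrection (NormedField.toAbsoluteValue ℂ) (u (2 ^ n * w))|
        ≤ (1 / 4 : ℝ) ^ n * (1 / 4) * C := by gcongr; exact hC _
      _ = C / 4 * (1 / 4) ^ n := by ring

omit [W.IsElliptic] in
/-- `λ₁ ∘ u = ½ log⁺|℘ − b₂/12|` off the lattice (`x(u(w)) = ℘(w) − b₂/12`).
[cite: Silverman1994, proof of Thm VI.1.1] -/
theorem naiveLocalHeight_param_of_notMem {w : ℂ} (hw : w ∉ L.lattice) :
    naiveLocalHeight (NormedField.toAbsoluteValue ℂ) (u w) = 1 / 2 * Real.posLog ‖℘[L] w - W.b₂ / 12‖ := by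
  obtain ⟨h, e⟩ := hu w hw
  rw [e, naiveLocalHeight_some]
  rfl

/-- Tate's `λ = λ₁ + μ` along the parametrisation is continuous off the lattice (ATAEC
Thm. VI.1.1(a)(i) for Tate's construction, transported to `ℂ`). [cite: Silverman1994, Thm VI.1.1] -/
theorem continuousAt_neronLocalHeight_param {w₀ : ℂ} (hw₀ : w₀ ∉ L.lattice) :
    ContinuousAt (fun w : ℂ => neronLocalHeight (NormedField.toAbsoluteValue ℂ) (u w)) w₀ := by
  have hopen : IsOpen ((L.lattice : Set ℂ)ᶜ) := L.isClosed_lattice.isOpen_compl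
  have h℘ : ContinuousAt ℘[L] w₀ :=
    (L.differentiableOn_weierstrassP.differentiableAt (hopen.mem_nhds hw₀)).continuousAt
  have h1 : ContinuousAt (fun w : ℂ => naiveLocalHeight (NormedField.toAbsoluteValue ℂ) (u w)) w₀ := by
    have hc : ContinuousAt (fun w : ℂ => 1 / 2 * Real.posLog ‖℘[L] w - W.b₂ / 12‖) w₀ :=
      continuousAt_const.mul (Real.continuous_posLog.continuousAt.comp
        (continuous_norm.continuousAt.comp (h℘.sub continuousAt_const)))
    refine hc.congr ?_
    filter_upwards [hopen.mem_nhds hw₀] with w hw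
    exact (naiveLocalHeight_param_of_notMem u hu hw).symm
  exact h1.add (continuous_tateMu_param u hu).continuousAt

/-! ### ATAEC Thm. VI.3.2: Tate's series along the parametrisation is the Néron function -/

variable (h₂ : L.g₂ = W.c₄ / 12) (h₃ : L.g₃ = W.c₆ / 216)
include h₂ h₃

omit hu [W.IsElliptic] in
/-- `Δ(Λ) = g₂³ − 27g₃² = Δ(W)` for a period lattice of `W` (`g₂ = c₄/12`, `g₃ = c₆/216`;
`1728Δ = c₄³ − c₆²`). [cite: SilvermanAEC2009, III.1] -/
theorem discr_eq_Δ : L.g₂ ^ 3 - 27 * L.g₃ ^ 2 = W.Δ := by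
  rw [h₂, h₃]
  exact W.c₄_div_cube_sub_eq_Δ

omit h₂ h₃ in
/-- **The duplication law for Tate's `λ` along the parametrisation** (ATAEC Thm. VI.1.1(a)(iii),
the tree's `neronLocalHeight_two_nsmul_of` with Tate's Lemma VI.1.2
`tateCorrection_bounded_of_two_ne_zero`): for `2w ∉ Λ`,
`λ(u(2w)) = 4λ(u(w)) − log|℘'(w)| + ¼ log|Δ(W)|` (`2y + a₁x + a₃ = ℘'(w)` for the point `u(w)`).
[cite: Silverman1994, Thm VI.1.1(a)(iii)] -/
theorem neronLocalHeight_param_two_mul {w : ℂ} (h2w : 2 * w ∉ L.lattice) :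
    neronLocalHeight (NormedField.toAbsoluteValue ℂ) (u (2 * w)) =
      4 * neronLocalHeight (NormedField.toAbsoluteValue ℂ) (u w) - Real.log ‖℘'[L] w‖ +
        1 / 4 * Real.log ‖W.Δ‖ := by
  have hw : w ∉ L.lattice := fun h => h2w (by simpa [two_mul] using add_mem h h)
  obtain ⟨hxy, e⟩ := hu w hw
  have hf := tateCorrection_bounded_of_two_ne_zero (NormedField.toAbsoluteValue ℂ) W two_ne_zero
  have hu2 : u (2 * w) = (2 : ℕ) • u w := by rw [two_mul, map_add, two_nsmul]
  have hne : (2 : ℕ) • u w ≠ 0 := by rw [← hu2]; exact param_ne_zero_of_notMem u hu h2w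
  rw [e] at hne
  have key := neronLocalHeight_two_nsmul_of (NormedField.toAbsoluteValue ℂ) hf hxy
    (by convert hne using 2)
  have hy : 2 * ((℘'[L] w - W.a₁ * (℘[L] w - W.b₂ / 12) - W.a₃) / 2) +
      W.a₁ * (℘[L] w - W.b₂ / 12) + W.a₃ = ℘'[L] w := by ring
  rw [hy] at key
  rw [hu2, e, ← toAbsoluteValue_complex_apply (℘'[L] w), ← toAbsoluteValue_complex_apply W.Δ]
  convert key using 3

/-- **Silverman ATAEC Thm. VI.3.2 (with Thm. VI.1.1(b))**: along the analytic parametrisation `u`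
of `W(ℂ)` by `ℂ/Λ` (period lattice `Λ` of `W`, `g₂(Λ) = c₄/12`, `g₃(Λ) = c₆/216`), Tate's series
`λ = λ₁ + μ` for the absolute value of `ℂ` equals the `σ`-form Néron function of `Λ`:
`λ(u(w)) = neronSigma Λ w` for every `w ∉ Λ`. Proof (Tate's uniqueness argument, ATAEC Thm.
VI.1.1 uniqueness + Thm. VI.3.2 existence): `G = λ ∘ u − neronSigma` is bounded off `Λ`
(Tate: `|λ − λ₁| ≤ C/3`; `exists_bound_posLog_sub_neronSigma`), satisfies `G(2w) = 4G(w)`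
(both duplication laws, `Δ(Λ) = Δ(W)`), hence vanishes at every `w` with `2ⁿw ∉ Λ` for all `n`;
these are dense (their complement is countable) and `G` is continuous off `Λ`
(`continuousAt_neronLocalHeight_param`, `continuousAt_neronSigma`), so `G = 0` off `Λ`.
[cite: Silverman1994, Thm VI.3.2] -/
theorem neronLocalHeight_param_eq_neronSigma {w : ℂ} (hw : w ∉ L.lattice) :
    neronLocalHeight (NormedField.toAbsoluteValue ℂ) (u w) = L.neronSigma w := by
  set G : ℂ → ℝ := fun w => neronLocalHeight (NormedField.toAbsoluteValue ℂ) (u w) - L.neronSigma w with hG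
  have hΔ : L.g₂ ^ 3 - 27 * L.g₃ ^ 2 = W.Δ := discr_eq_Δ h₂ h₃
  -- (a) duplication
  have hdup : ∀ z : ℂ, 2 * z ∉ L.lattice → G (2 * z) = 4 * G z := by
    intro z h2z
    simp only [hG, neronLocalHeight_param_two_mul u hu h2z, L.neronSigma_two_mul h2z, hΔ]
    ring
  -- (b) boundedness
  obtain ⟨C, hC⟩ := tateCorrection_bounded_of_two_ne_zero (NormedField.toAbsoluteValue ℂ) W two_ne_zero
  obtain ⟨B, hB⟩ := L.exists_bound_posLog_sub_neronSigma (W.b₂ / 12)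
  have hbound : ∀ z : ℂ, z ∉ L.lattice → |G z| ≤ C / 3 + B := by
    intro z hz
    have h1 := abs_neronLocalHeight_sub_naiveLocalHeight_le_of (NormedField.toAbsoluteValue ℂ) hC (u z)
    have h2 := hB z hz
    rw [naiveLocalHeight_param_of_notMem u hu hz] at h1
    calc |G z| = |(neronLocalHeight (NormedField.toAbsoluteValue ℂ) (u z) -
          1 / 2 * Real.posLog ‖℘[L] z - W.b₂ / 12‖) +
          (1 / 2 * Real.posLog ‖℘[L] z - W.b₂ / 12‖ - L.neronSigma z)| := by
            simp only [hG]; ring_nf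
      _ ≤ _ := (abs_add_le _ _).trans (add_le_add h1 h2)
  -- (c) vanishing on the set `D` of points with `2ⁿ z ∉ Λ` for all `n`
  set D : Set ℂ := {z | ∀ n : ℕ, (2 : ℂ) ^ n * z ∉ L.lattice} with hD
  have hiter : ∀ z ∈ D, ∀ n : ℕ, G ((2 : ℂ) ^ n * z) = 4 ^ n * G z := by
    intro z hz n
    induction n with
    | zero => simp
    | succ n ih =>
      have h2 : 2 * ((2 : ℂ) ^ n * z) ∉ L.lattice := by
        have := hz (n + 1)
        rwa [pow_succ, mul_comm ((2 : ℂ) ^ n) 2, mul_assoc] at this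
      rw [pow_succ, mul_comm ((2 : ℂ) ^ n) 2, mul_assoc, hdup _ h2, ih]
      ring
  have hzero : ∀ z ∈ D, G z = 0 := by
    intro z hz
    have hz0 : z ∉ L.lattice := by simpa using hz 0
    have hle : ∀ n : ℕ, |G z| ≤ (C / 3 + B) * (1 / 4 : ℝ) ^ n := by
      intro n
      have h := hbound _ (hz n)
      rw [hiter z hz n, abs_mul, abs_of_pos (by positivity : (0 : ℝ) < 4 ^ n)] at h
      rw [show (C / 3 + B) * (1 / 4 : ℝ) ^ n = (C / 3 + B) / 4 ^ n by
        rw [one_div, inv_pow]; ring, le_div_iff₀ (by positivity)]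
      linarith
    have ht : Tendsto (fun n : ℕ => (C / 3 + B) * (1 / 4 : ℝ) ^ n) atTop (𝓝 ((C / 3 + B) * 0)) :=
      (tendsto_pow_atTop_nhds_zero_of_lt_one (by norm_num) (by norm_num)).const_mul _
    rw [mul_zero] at ht
    have habs : |G z| ≤ 0 := ge_of_tendsto ht (Eventually.of_forall hle)
    exact abs_nonpos_iff.mp habs
  -- (d) density of `D` and continuity of `G` off `Λ`
  have hΛcount : (L.lattice : Set ℂ).Countable := by
    have : (L.lattice : Set ℂ) = Set.range fun p : ℤ × ℤ => (p.1 : ℂ) * L.ω₁ + (p.2 : ℂ) * L.ω₂ := by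
      ext x
      simp only [SetLike.mem_coe, mem_lattice, Set.mem_range, Prod.exists]
    rw [this]
    exact Set.countable_range _
  have hDc : Dᶜ.Countable := by
    have hsub : Dᶜ ⊆ ⋃ n : ℕ, (fun ℓ : ℂ => ℓ / 2 ^ n) '' (L.lattice : Set ℂ) := by
      intro z hz
      simp only [hD, Set.mem_compl_iff, Set.mem_setOf_eq, not_forall, not_not] at hz
      obtain ⟨n, hn⟩ := hz
      refine Set.mem_iUnion.mpr ⟨n, ⟨(2 : ℂ) ^ n * z, hn, ?_⟩⟩
      simp
    exact (Set.countable_iUnion fun n => hΛcount.image _).mono hsub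
  have hDdense : Dense D := by simpa using hDc.dense_compl ℝ
  have hcont : ContinuousAt G w :=
    (continuousAt_neronLocalHeight_param u hu hw).sub (L.continuousAt_neronSigma hw)
  have hne : (𝓝[D] w).NeBot := mem_closure_iff_nhdsWithin_neBot.mp (hDdense w)
  have hlim1 : Tendsto G (𝓝[D] w) (𝓝 (G w)) := hcont.tendsto.mono_left nhdsWithin_le_nhds
  have hlim2 : Tendsto G (𝓝[D] w) (𝓝 0) :=
    tendsto_const_nhds.congr' (eventually_mem_nhdsWithin.mono fun z hz => (hzero z hz).symm)
  have := tendsto_nhds_unique hlim1 hlim2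
  simp only [hG] at this
  linarith

end Param

/-! ### ATAEC Thm. VI.3.4(b): `neronLocalHeight_eq_neronFunction` from the `q`-product of `σ` -/

/-- **`neronLocalHeight_eq_neronFunction` (ATAEC Thm. VI.3.4 with VI.1.1(b)) from the
`q`-product expansion of `σ` (Thm. I.6.4)**: Tate's series along `z ↦ u(cz)` is
`neronSigma (cΛ_τ) (cz)` (Thm. VI.3.2, `neronLocalHeight_param_eq_neronSigma`), which is
`neronSigma Λ_τ z` (homothety invariance) and equals `neronFunction τ z` (Thm. VI.3.4,
`neronSigma_ofUpperHalfPlane_eq_neronFunction`). [cite: Silverman1994, Thm VI.3.4] -/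
theorem neronLocalHeight_eq_neronFunction_of_qProduct
    (h64 : weierstrassSigma_ofUpperHalfPlane_eq_qProduct) : neronLocalHeight_eq_neronFunction := by
  intro W _ τ c hc h₂ h₃ u hu z hz
  have hcz : c * z ∉ ((ofUpperHalfPlane τ).mulLeft c hc).lattice :=
    fun h => hz (mul_mem_mulLeft_lattice.mp h)
  rw [neronLocalHeight_param_eq_neronSigma u hu h₂ h₃ hcz, (ofUpperHalfPlane τ).neronSigma_mulLeft hc hz,
    neronSigma_ofUpperHalfPlane_eq_neronFunction h64 hz]

/-! ### Consequences for the Szpiro ⇒ Lang frontier -/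

open IsDedekindDomain in
/-- **Szpiro ⇒ Lang's height lower bound over `ℚ`, conditional on Petsche's Lemma 3, the
Kodaira–Néron facts and the `q`-product of `σ` only** (`szpiro_imp_langHeightLowerBoundConjecture`;
Hindry–Silverman 1988, Thm. 0.3): ATAEC Thm. VI.3.4 is no longer a hypothesis — it is
`neronLocalHeight_eq_neronFunction_of_qProduct h64`. [cite: HindrySilverman1988, Thm 0.3] -/
theorem szpiro_imp_langHeightLowerBoundConjecture_of_lemma3_kodairaNeron_qProduct
    (h3 : Petsche2006_lemma3)
    (h4 : ∀ (W : WeierstrassCurve ℚ) (v : HeightOneSpectrum ℤ),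
      (W.localMinimalModel v).index_goodReductionSubgroup_le_four (v.adicCompletionIntegers ℚ))
    (hsplit : ∀ (W : WeierstrassCurve ℚ) (v : HeightOneSpectrum ℤ),
      (W.localMinimalModel v).index_goodReductionSubgroup_of_hasSplitMultiplicativeReduction
        (v.adicCompletionIntegers ℚ))
    (h64 : weierstrassSigma_ofUpperHalfPlane_eq_qProduct) :
    szpiro_imp_langHeightLowerBoundConjecture :=
  szpiro_imp_langHeightLowerBoundConjecture_of_uniformisationFacts h3 h4 hsplit
    (neronLocalHeight_eq_neronFunction_of_qProduct h64)

open IsDedekindDomain in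
/-- **Petsche 2006, Prop. 7 over `ℚ`, conditional on the same three facts.**
[cite: Petsche2006, Prop. 7] -/
theorem Petsche2006_card_smallPoints_le_of_lemma3_kodairaNeron_qProduct
    (h3 : Petsche2006_lemma3)
    (h4 : ∀ (W : WeierstrassCurve ℚ) (v : HeightOneSpectrum ℤ),
      (W.localMinimalModel v).index_goodReductionSubgroup_le_four (v.adicCompletionIntegers ℚ))
    (hsplit : ∀ (W : WeierstrassCurve ℚ) (v : HeightOneSpectrum ℤ),
      (W.localMinimalModel v).index_goodReductionSubgroup_of_hasSplitMultiplicativeReduction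
        (v.adicCompletionIntegers ℚ))
    (h64 : weierstrassSigma_ofUpperHalfPlane_eq_qProduct) :
    Petsche2006_card_smallPoints_le :=
  Petsche2006_card_smallPoints_le_of_uniformisationFacts h3 h4 hsplit
    (neronLocalHeight_eq_neronFunction_of_qProduct h64)

/-- **The archimedean step of Petsche's Prop. 7 from the `q`-product of `σ` alone.**
[cite: Petsche2006, proof of Prop. 7] -/
theorem Petsche2006_exists_subset_le_neronLocalHeight_real_of_qProduct
    (h64 : weierstrassSigma_ofUpperHalfPlane_eq_qProduct) :
    Petsche2006_exists_subset_le_neronLocalHeight_real :=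
  Petsche2006_exists_subset_le_neronLocalHeight_real_of_neronFunction
    (neronLocalHeight_eq_neronFunction_of_qProduct h64)

end Literature.NumberTheory.EllipticCurves

end
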